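/-
Copyright (c) 2026 the pub-hodgecm-mathlib formalisation cell (harness21).  Prover seat hodgecm-mathlib-LH5-p02 (g3): line LH3 (closer stub `stub_N9`, organ J),
brick (M-UNFOLD) (u2) — the CAYLEY-CHART TORUS through the block decomposition (LH3-plan (g3) deal 2026-09-02T07:54:09Z, RULINGS #8∕#9; (G′-CANCEL)'s `hTAβ`).
-/
import Literature.NumberTheory.Automorphic.ArchInnerFormSemiregularCentralizerBlockCayley   -- ★ p850544: [5β]∕[6β], `conj_monomialGL_boostStd_eq_gprimeSplitGL`, `gprimeTorus_insert_mem_centralizer`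
import Mathlib.Tactic.Group
import HarnessLib

/-!
# The split chart torus `T_{insert w₀ S′}` under the block decomposition: its `B`-components are exactly the 2 × 2 boosts
# ((M-UNFOLD) (u2), clause [7β]; Rogawski 1990 §3.1, §3.6, §8.2 p. 122; Knapp 1986 V §3; Shelstad 1979 §4)

Topic `NumberTheory/Automorphic`; namespace `Literature.NumberTheory.Automorphic.UnitaryGroup`.  THEOREMS ONLY (no `def`, no instance, no notation, no axiom, no named fact,
no `sorry`).  Cell `pub/hodgecm-mathlib`, crux H413 (`stmt-HodgeConjecture-24833`), F0∕P3c line LH3 (closer stub `stub_N9`, organ J).  ★ p850499∕p850544 give the block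
decomposition `e : M′ = Z(gprimeTorus α S′ p) ≃ₜ* B × K` with the compact-chart torus `T′ = e⁻¹(A × K)` (`A` = unit diagonals) and the blocks of Cayley-chart points.  This file adds
the one remaining clause the (G′-CANCEL) head ★ `Rogawski1990.ArchChartOrbGBlockDescents` (LH3-p03 (g4), binder `hTAβ`) consumes:
* [7β] **`g ∈ T_{insert w₀ S′} ↔ ∃ x θ, (e g).1 = (boostStd (formRe α w₀ ∘ τ₀) ![x, 0, θ]).submatrix ![0, 2] ![0, 2]`** — the split chart torus is `e⁻¹(A_hyp × K)` with `A_hyp`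
  the BOOST torus of `B` (through (B-STD)'s `φ : B ≃ₜ* U(J)`, RULINGS #9, `A_hyp ↦ torusU`).
Proof: the split torus is the centraliser of ONE of its regular points `c₁` (★ `chartTorusG_eq_centralizer`; `c₁ := update p w₀ (1, p_{w₀,1}, p_{w₀,0})`, regular because
`x = 1 ≠ 0` at `w₀` and `p` is regular elsewhere); `e` is a group isomorphism and `K` is commutative, so `g` commutes with `γ₁ = gprimeTorus α S♯ c₁` iff the `B`-components
commute; the commutant of the regular 2 × 2 boost `(e γ₁).1` ([5β]) inside `B` is the boost torus — read off ★ `exists_eq_boostStd_of_commute` through the endoscopic pattern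
`endoGL (·, 1)`; conversely boosts commute (`boostStd_add`).
* §1 tools: `submatrix_pattern_mul` (the `{0,2}`-block of a product of endoscopic-pattern matrices), `submatrix_boostStd_mul`, `submatrix_boostStd_comm`, `submatrix_boostStd_eq_of`,
  `boostStd_submatrix_indep`.
* §2 **`exists_continuousMulEquiv_centralizer_gprimeTorus_semireg_cayley_torus`** — clauses [1]–[10], [5β], [6β] of ★ p850544 VERBATIM, then [7β].
HONEST LABEL: HC_CM is proved only modulo the 7 printed citations (2 remaining named inputs: hLiu418 = `stmt-HodgeConjecture-24832`, h413 = `stmt-HodgeConjecture-24833`) until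
rung 0 closes; count-neutral group-theoretic bookkeeping under organ J of `stub_N9`.

## References
* [Rogawski1990] J. D. Rogawski, *Automorphic Representations of Unitary Groups in Three Variables*, Ann. of Math. Stud. 123 (1990), §3.1 p. 19, §3.6 p. 31, §8.2 p. 122.
* [Knapp1986] A. W. Knapp, *Representation Theory of Semisimple Groups* (1986), Ch. V §3 (the commutant of a regular boost).
* [Shelstad1979] D. Shelstad, *Characters and inner forms of a quasi-split group over ℝ*, Compositio Math. 39 (1979), §4 pp. 22–25.
-/

set_option autoImplicit false

noncomputable section

open NumberField NumberField.InfinitePlace Matrix Complex Topology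
open Literature.NumberTheory.Rogawski1990 Literature.LinearAlgebra.Matrix
open scoped MatrixGroups Matrix ComplexConjugate Classical

namespace Literature.NumberTheory.Automorphic.UnitaryGroup

/-! ## §1 The `{0,2}`-block of endoscopic-pattern matrices -/

section Tools

/-- **The `{0,2}`-block is multiplicative on endoscopic-pattern matrices**: if `A` has zero `(0,1)`, `(2,1)` entries and `C` zero `(1,0)`, `(1,2)` entries then
`(A · C).submatrix ![0,2] ![0,2] = A.submatrix ![0,2] ![0,2] · C.submatrix ![0,2] ![0,2]`. [cite: Rogawski1990, §4.8 Case (a) p. 53] -/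
theorem submatrix_pattern_mul {R : Type*} [CommRing R] (A C : Matrix (Fin 3) (Fin 3) R) (hA01 : A 0 1 = 0) (hA21 : A 2 1 = 0) :
    (A * C).submatrix ![0, 2] ![0, 2] = A.submatrix ![0, 2] ![0, 2] * C.submatrix ![0, 2] ![0, 2] := by
  ext i j
  fin_cases i <;> fin_cases j <;>
    simp [Matrix.submatrix_apply, Matrix.mul_apply, Fin.sum_univ_three, Fin.sum_univ_two, hA01, hA21]

/-- `boostStd b c` has the endoscopic pattern: its `(0,1)`, `(2,1)` entries vanish. [cite: Knapp1986, Ch. V §3] -/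
theorem boostStd_apply_zero_one (b c : Fin 3 → ℝ) : boostStd b c 0 1 = 0 ∧ boostStd b c 2 1 = 0 := ⟨rfl, rfl⟩

/-- **The `{0,2}`-blocks of boosts multiply like boosts**: `B₂(c) · B₂(c′) = (boostStd b c · boostStd b c′).submatrix …`. [cite: Knapp1986, Ch. V §3] -/
theorem submatrix_boostStd_mul (b c c' : Fin 3 → ℝ) :
    (boostStd b c).submatrix ![0, 2] ![0, 2] * (boostStd b c').submatrix ![0, 2] ![0, 2] = (boostStd b c * boostStd b c').submatrix ![0, 2] ![0, 2] :=
  (submatrix_pattern_mul _ _ (boostStd_apply_zero_one b c).1 (boostStd_apply_zero_one b c).2).symm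

/-- **Boost blocks commute** (`b₀ b₂ < 0`): `B₂(c) · B₂(c′) = B₂(c′) · B₂(c)` (one-parameter-group law ★ `boostStd_add`). [cite: Knapp1986, Ch. V §3] -/
theorem submatrix_boostStd_comm {b : Fin 3 → ℝ} (hb : b 0 * b 2 < 0) (c c' : Fin 3 → ℝ) :
    (boostStd b c).submatrix ![0, 2] ![0, 2] * (boostStd b c').submatrix ![0, 2] ![0, 2] =
      (boostStd b c').submatrix ![0, 2] ![0, 2] * (boostStd b c).submatrix ![0, 2] ![0, 2] := by
  rw [submatrix_boostStd_mul, submatrix_boostStd_mul, ← boostStd_add hb, ← boostStd_add hb, add_comm]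

/-- The `{0,2}`-block of `boostStd b c` does not read `c 1`. [cite: Knapp1986, Ch. V §3] -/
theorem submatrix_boostStd_eq_of (b c : Fin 3 → ℝ) :
    (boostStd b c).submatrix ![0, 2] ![0, 2] = (boostStd b ![c 0, 0, c 2]).submatrix ![0, 2] ![0, 2] := by
  ext i j
  fin_cases i <;> fin_cases j <;> rfl

/-- `boostStd b c` IS the endoscopic pattern of its `{0,2}`-block and the phase `e^{i c₁}`. [cite: Rogawski1990, §4.8 Case (a) p. 53] [cite: Knapp1986, Ch. V §3] -/
theorem boostStd_eq_pattern (b c : Fin 3 → ℝ) :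
    boostStd b c = !![(boostStd b c).submatrix ![0, 2] ![0, 2] 0 0, 0, (boostStd b c).submatrix ![0, 2] ![0, 2] 0 1;
      0, Complex.exp ((c 1 : ℂ) * I), 0;
      (boostStd b c).submatrix ![0, 2] ![0, 2] 1 0, 0, (boostStd b c).submatrix ![0, 2] ![0, 2] 1 1] := by
  ext i j
  fin_cases i <;> fin_cases j <;> rfl

end Tools

/-! ## §2 The split chart torus through the block decomposition -/

section CayleyTorus

variable (L : Type) [Field L] [NumberField L] [IsCMField L] (α : Fin 3 → L)
  (S' : Finset {w : InfinitePlace L // IsComplex w}) (w₀ : {w : InfinitePlace L // IsComplex w})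

set_option maxHeartbeats 4000000 in
/-- **(M-UNFOLD) (u2) — THE SPLIT CHART TORUS THROUGH `e`.**  Hypotheses as ★ `…_semireg_cayley`; clauses [1]–[10], [5β], [6β] VERBATIM, and
[7β] `g ∈ T_{insert w₀ S′} ↔ ∃ x θ, (e g).1 = (boostStd (formRe α w₀ ∘ τ₀) ![x, 0, θ]).submatrix ![0, 2] ![0, 2]` (as matrices).
[cite: Rogawski1990, §3.1 p. 19; §3.6 p. 31; §8.2 p. 122] [cite: Knapp1986, Ch. V §3] [cite: Shelstad1979, §4 pp. 22–25] -/
theorem exists_continuousMulEquiv_centralizer_gprimeTorus_semireg_cayley_torus (hα : ∀ i, α i ≠ 0) (hS' : ∀ w, w ∈ S' → w ∈ splitChartPlaces L α)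
    (hw₀ : w₀ ∉ S') (hsp : w₀ ∈ splitChartPlaces L α) (p : {w : InfinitePlace L // IsComplex w} → Fin 3 → ℝ) (hp : p w₀ 0 = p w₀ 2)
    (h01 : Circle.exp (p w₀ 0) ≠ Circle.exp (p w₀ 1))
    (hreg : ∀ w, w ≠ w₀ → w ∉ S' → Function.Injective fun i : Fin 3 => Circle.exp (p w i)) (hregS : ∀ w, w ∈ S' → p w 0 ≠ 0) :
    ∃ (K : Subgroup ↥(Subgroup.centralizer ({gprimeTorus L α S' p} : Set ↥(arch (↥(maximalRealSubfield L)) L (IsCMField.complexConj L) 3 (Matrix.diagonal α)))))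
      (e : ↥(Subgroup.centralizer ({gprimeTorus L α S' p} : Set ↥(arch (↥(maximalRealSubfield L)) L (IsCMField.complexConj L) 3 (Matrix.diagonal α)))) ≃ₜ*
        ↥(unitaryGroupOfForm (starRingEnd ℂ) ((Matrix.diagonal ![α (lineOf (formSign L α w₀) 0), α (lineOf (formSign L α w₀) 2)]).map w₀.1.embedding)) × ↥K),
      IsClosed (K : Set ↥(Subgroup.centralizer ({gprimeTorus L α S' p} : Set ↥(arch (↥(maximalRealSubfield L)) L (IsCMField.complexConj L) 3 (Matrix.diagonal α))))) ∧
      (∀ k : ↥(Subgroup.centralizer ({gprimeTorus L α S' p} : Set ↥(arch (↥(maximalRealSubfield L)) L (IsCMField.complexConj L) 3 (Matrix.diagonal α)))),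
        k ∈ K → (k : ↥(arch (↥(maximalRealSubfield L)) L (IsCMField.complexConj L) 3 (Matrix.diagonal α))) ∈ chartTorusG L α S') ∧
      (∀ k₁, k₁ ∈ K → ∀ k₂, k₂ ∈ K → k₁ * k₂ = k₂ * k₁) ∧
      (∀ g : ↥(Subgroup.centralizer ({gprimeTorus L α S' p} : Set ↥(arch (↥(maximalRealSubfield L)) L (IsCMField.complexConj L) 3 (Matrix.diagonal α)))),
        (g : ↥(arch (↥(maximalRealSubfield L)) L (IsCMField.complexConj L) 3 (Matrix.diagonal α))) ∈ chartTorusG L α S' ↔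
        (((e g).1 : ↥(unitaryGroupOfForm (starRingEnd ℂ) ((Matrix.diagonal ![α (lineOf (formSign L α w₀) 0), α (lineOf (formSign L α w₀) 2)]).map w₀.1.embedding))) :
          GL (Fin 2) ℂ) ∈ Set.range (circleDiagonal 2)) ∧
      (∀ c : {w : InfinitePlace L // IsComplex w} → Fin 3 → ℝ,
        (((e ⟨gprimeTorus L α S' c, gprimeTorus_mem_centralizer L α S' p c⟩).1 :
          ↥(unitaryGroupOfForm (starRingEnd ℂ) ((Matrix.diagonal ![α (lineOf (formSign L α w₀) 0), α (lineOf (formSign L α w₀) 2)]).map w₀.1.embedding))) : GL (Fin 2) ℂ) =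
          circleDiagonal 2 ![Circle.exp (c w₀ 0), Circle.exp (c w₀ 2)]) ∧
      (∀ c : {w : InfinitePlace L // IsComplex w} → Fin 3 → ℝ,
        ((((e ⟨gprimeTorus L α S' c, gprimeTorus_mem_centralizer L α S' p c⟩).2 : ↥K) :
          ↥(Subgroup.centralizer ({gprimeTorus L α S' p} : Set ↥(arch (↥(maximalRealSubfield L)) L (IsCMField.complexConj L) 3 (Matrix.diagonal α))))) :
            ↥(arch (↥(maximalRealSubfield L)) L (IsCMField.complexConj L) 3 (Matrix.diagonal α))) =
          gprimeTorus L α S' (Function.update c w₀ ![0, c w₀ 1, 0])) ∧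
      Subgroup.map (e : ↥(Subgroup.centralizer ({gprimeTorus L α S' p} : Set ↥(arch (↥(maximalRealSubfield L)) L (IsCMField.complexConj L) 3 (Matrix.diagonal α)))) →*
          ↥(unitaryGroupOfForm (starRingEnd ℂ) ((Matrix.diagonal ![α (lineOf (formSign L α w₀) 0), α (lineOf (formSign L α w₀) 2)]).map w₀.1.embedding)) × ↥K)
        ((chartTorusG L α S').subgroupOf (Subgroup.centralizer ({gprimeTorus L α S' p} : Set ↥(arch (↥(maximalRealSubfield L)) L (IsCMField.complexConj L) 3 (Matrix.diagonal α))))) =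
        (((circleDiagonal 2).codRestrict (unitaryGroupOfForm (starRingEnd ℂ) ((Matrix.diagonal ![α (lineOf (formSign L α w₀) 0), α (lineOf (formSign L α w₀) 2)]).map w₀.1.embedding))
            (circleDiagonal_mem_archLocal_diagonal L 2 ![α (lineOf (formSign L α w₀) 0), α (lineOf (formSign L α w₀) 2)] w₀)).range).prod ⊤ ∧
      -- [8] the inverse on `B × 1` is the block embedding through ★ `archPiEquivCM`, the relabelling `e_{τ₀}` and ★ `endoEmb`
      (∀ b : ↥(unitaryGroupOfForm (starRingEnd ℂ) ((Matrix.diagonal ![α (lineOf (formSign L α w₀) 0), α (lineOf (formSign L α w₀) 2)]).map w₀.1.embedding)),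
        ((e.symm (b, 1) : ↥(Subgroup.centralizer ({gprimeTorus L α S' p} : Set ↥(arch (↥(maximalRealSubfield L)) L (IsCMField.complexConj L) 3 (Matrix.diagonal α))))) : ↥(arch (↥(maximalRealSubfield L)) L (IsCMField.complexConj L) 3 (Matrix.diagonal α))) =
          (archPiEquivCM 3 L (Matrix.diagonal α)).symm (Pi.mulSingle w₀
            ((ContinuousMulEquiv.restrictSubgroup
            (GLn.conjEquiv (Matrix.GeneralLinearGroup.mkOfDetNeZero _ (det_monomial_one_ne_zero 3 (lineOf (formSign L α w₀)))))
            (archLocal L 3 (Matrix.diagonal (α ∘ (lineOf (formSign L α w₀)))) w₀) (archLocal L 3 (Matrix.diagonal α) w₀)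
            (mem_archLocal_comp_perm_iff_conj_mem L 3 α w₀ (lineOf (formSign L α w₀))))
              ((endoEmb (starRingEnd ℂ) ((Matrix.diagonal ![(α ∘ (lineOf (formSign L α w₀))) 0, (α ∘ (lineOf (formSign L α w₀))) 2]).map w₀.1.embedding)
              ((Matrix.diagonal ![(α ∘ (lineOf (formSign L α w₀))) 1]).map w₀.1.embedding) ((Matrix.diagonal (α ∘ (lineOf (formSign L α w₀)))).map w₀.1.embedding)
              (endoForm_archLocal_diagonal L (α ∘ (lineOf (formSign L α w₀))) w₀)) (b, 1))))) ∧
      -- [9] the `w₀`-component of `g ∈ M′` is the block embedding of `((e g).1, u)` for some `u ∈ U(σ_{w₀} α (τ₀ 1))(ℂ)`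
      (∀ g : ↥(Subgroup.centralizer ({gprimeTorus L α S' p} : Set ↥(arch (↥(maximalRealSubfield L)) L (IsCMField.complexConj L) 3 (Matrix.diagonal α)))), ∃ u : ↥(unitaryGroupOfForm (starRingEnd ℂ) ((Matrix.diagonal ![(α ∘ (lineOf (formSign L α w₀))) 1]).map w₀.1.embedding)),
        archPiEquivCM 3 L (Matrix.diagonal α) (g : ↥(arch (↥(maximalRealSubfield L)) L (IsCMField.complexConj L) 3 (Matrix.diagonal α))) w₀ =
          (ContinuousMulEquiv.restrictSubgroup
            (GLn.conjEquiv (Matrix.GeneralLinearGroup.mkOfDetNeZero _ (det_monomial_one_ne_zero 3 (lineOf (formSign L α w₀)))))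
            (archLocal L 3 (Matrix.diagonal (α ∘ (lineOf (formSign L α w₀)))) w₀) (archLocal L 3 (Matrix.diagonal α) w₀)
            (mem_archLocal_comp_perm_iff_conj_mem L 3 α w₀ (lineOf (formSign L α w₀))))
            ((endoEmb (starRingEnd ℂ) ((Matrix.diagonal ![(α ∘ (lineOf (formSign L α w₀))) 0, (α ∘ (lineOf (formSign L α w₀))) 2]).map w₀.1.embedding)
              ((Matrix.diagonal ![(α ∘ (lineOf (formSign L α w₀))) 1]).map w₀.1.embedding) ((Matrix.diagonal (α ∘ (lineOf (formSign L α w₀)))).map w₀.1.embedding)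
              (endoForm_archLocal_diagonal L (α ∘ (lineOf (formSign L α w₀))) w₀)) ((e g).1, u))) ∧
      -- [10] `e` is the identity on `K`
      (∀ k : ↥(Subgroup.centralizer ({gprimeTorus L α S' p} : Set ↥(arch (↥(maximalRealSubfield L)) L (IsCMField.complexConj L) 3 (Matrix.diagonal α)))), ∀ hk : k ∈ K, e k = (1, ⟨k, hk⟩)) ∧
      -- [5β] the `B`-component of a CAYLEY-chart point is the `{0,2}`-block of the standard boost
      (∀ c : {w : InfinitePlace L // IsComplex w} → Fin 3 → ℝ,
        ((((e ⟨gprimeTorus L α (insert w₀ S') c, gprimeTorus_insert_mem_centralizer L α hw₀ hsp hp c⟩).1 : ↥(unitaryGroupOfForm (starRingEnd ℂ) ((Matrix.diagonal ![α (lineOf (formSign L α w₀) 0), α (lineOf (formSign L α w₀) 2)]).map w₀.1.embedding))) :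
            GL (Fin 2) ℂ) : Matrix (Fin 2) (Fin 2) ℂ) =
          (boostStd (formRe L α w₀ ∘ (lineOf (formSign L α w₀))) (c w₀)).submatrix ![0, 2] ![0, 2]) ∧
      -- [6β] its `K`-component is the same `r₀`-type chart point as on the compact chart
      (∀ c : {w : InfinitePlace L // IsComplex w} → Fin 3 → ℝ,
        ((((e ⟨gprimeTorus L α (insert w₀ S') c, gprimeTorus_insert_mem_centralizer L α hw₀ hsp hp c⟩).2 : ↥K) : ↥(Subgroup.centralizer ({gprimeTorus L α S' p} : Set ↥(arch (↥(maximalRealSubfield L)) L (IsCMField.complexConj L) 3 (Matrix.diagonal α))))) : ↥(arch (↥(maximalRealSubfield L)) L (IsCMField.complexConj L) 3 (Matrix.diagonal α))) =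
          gprimeTorus L α S' (Function.update c w₀ ![0, c w₀ 1, 0])) ∧
      -- [7β] the Cayley-chart torus read through `e`: its `B`-components are exactly the 2 × 2 boosts
      (∀ g : ↥(Subgroup.centralizer ({gprimeTorus L α S' p} : Set ↥(arch (↥(maximalRealSubfield L)) L (IsCMField.complexConj L) 3 (Matrix.diagonal α)))),
        (g : ↥(arch (↥(maximalRealSubfield L)) L (IsCMField.complexConj L) 3 (Matrix.diagonal α))) ∈ chartTorusG L α (insert w₀ S') ↔
          ∃ x θ : ℝ, ((((e g).1 : ↥(unitaryGroupOfForm (starRingEnd ℂ) ((Matrix.diagonal ![α (lineOf (formSign L α w₀) 0), α (lineOf (formSign L α w₀) 2)]).map w₀.1.embedding))) : GL (Fin 2) ℂ) : Matrix (Fin 2) (Fin 2) ℂ) =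
            (boostStd (formRe L α w₀ ∘ (lineOf (formSign L α w₀))) ![x, 0, θ]).submatrix ![0, 2] ![0, 2]) := by
  classical
  obtain ⟨K, e, h1, h2, h3, h4, h5, h6, h7, h8, h9, h10, h5b, h6b⟩ :=
    exists_continuousMulEquiv_centralizer_gprimeTorus_semireg_cayley L α S' w₀ hα hS' hw₀ hsp p hp h01 hreg hregS
  set REL := (ContinuousMulEquiv.restrictSubgroup
            (GLn.conjEquiv (Matrix.GeneralLinearGroup.mkOfDetNeZero _ (det_monomial_one_ne_zero 3 (lineOf (formSign L α w₀)))))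
            (archLocal L 3 (Matrix.diagonal (α ∘ (lineOf (formSign L α w₀)))) w₀) (archLocal L 3 (Matrix.diagonal α) w₀)
            (mem_archLocal_comp_perm_iff_conj_mem L 3 α w₀ (lineOf (formSign L α w₀)))) with hREL
  set ENDO := (endoEmb (starRingEnd ℂ) ((Matrix.diagonal ![(α ∘ (lineOf (formSign L α w₀))) 0, (α ∘ (lineOf (formSign L α w₀))) 2]).map w₀.1.embedding)
              ((Matrix.diagonal ![(α ∘ (lineOf (formSign L α w₀))) 1]).map w₀.1.embedding) ((Matrix.diagonal (α ∘ (lineOf (formSign L α w₀)))).map w₀.1.embedding)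
              (endoForm_archLocal_diagonal L (α ∘ (lineOf (formSign L α w₀))) w₀)) with hENDO
  let τ₀ : Fin 3 ≃ Fin 3 := lineOf (formSign L α w₀)
  let G := ↥(arch (↥(maximalRealSubfield L)) L (IsCMField.complexConj L) 3 (Matrix.diagonal α))
  let M' : Subgroup G := Subgroup.centralizer ({gprimeTorus L α S' p} : Set ↥(arch (↥(maximalRealSubfield L)) L (IsCMField.complexConj L) 3 (Matrix.diagonal α)))
  let Mτ : GL (Fin 3) ℂ := Matrix.GeneralLinearGroup.mkOfDetNeZero _ (det_monomial_one_ne_zero 3 τ₀)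
  refine ⟨K, e, h1, h2, h3, h4, h5, h6, h7, h8, h9, h10, h5b, h6b, ?_⟩
  -- the form data at `w₀`
  have hb : (formRe L α w₀ ∘ τ₀) 0 * (formRe L α w₀ ∘ τ₀) 2 < 0 := hsp.2
  have hb1 : (formRe L α w₀ ∘ τ₀) 1 ≠ 0 := formRe_ne_zero hα hsp.1 (τ₀ 1)
  -- the split chart is admissible
  have hSins : ∀ w, w ∈ insert w₀ S' → w ∈ splitChartPlaces L α := by
    intro w hw
    rcases Finset.mem_insert.1 hw with rfl | h
    · exact hsp
    · exact hS' w h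
  -- a REGULAR split-chart point `c₁` through the wall: `x = 1` at `w₀`, `p` elsewhere
  set c₁ : {w : InfinitePlace L // IsComplex w} → Fin 3 → ℝ := Function.update p w₀ ![1, p w₀ 1, p w₀ 0] with hc₁
  have hc₁w₀ : c₁ w₀ = ![1, p w₀ 1, p w₀ 0] := Function.update_self _ _ _
  have hc₁ne : ∀ w, w ≠ w₀ → c₁ w = p w := fun w hw => Function.update_of_ne hw _ _
  have hreg₁ : c₁ ∈ ArchCartan.RegG (insert w₀ S') := by
    rw [ArchCartan.mem_regG_iff]
    constructor
    · intro w hw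
      have hw0 : w ≠ w₀ := fun h => hw (h ▸ Finset.mem_insert_self _ _)
      have hwS : w ∉ S' := fun h => hw (Finset.mem_insert_of_mem h)
      rw [hc₁ne w hw0]
      exact hreg w hw0 hwS
    · intro w hw
      rcases Finset.mem_insert.1 hw with rfl | h
      · rw [hc₁w₀]; exact one_ne_zero
      · have hw0 : w ≠ w₀ := fun h' => hw₀ (h' ▸ h)
        rw [hc₁ne w hw0]
        exact hregS w h
  have hTins : chartTorusG L α (insert w₀ S') =
      Subgroup.centralizer ({gprimeTorus L α (insert w₀ S') c₁} : Set G) :=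
    chartTorusG_eq_centralizer L α (insert w₀ S') hα hSins hreg₁
  -- `γ₁ ∈ M′`, its blocks, and the 3 × 3 reading `endoGL ((e γ₁).1, u₁) = boostStd b (c₁ w₀)`
  let γ₁ : ↥M' := ⟨gprimeTorus L α (insert w₀ S') c₁, gprimeTorus_insert_mem_centralizer L α hw₀ hsp hp c₁⟩
  have hb₁ : ((((e γ₁).1 : ↥(unitaryGroupOfForm (starRingEnd ℂ) ((Matrix.diagonal ![α (lineOf (formSign L α w₀) 0), α (lineOf (formSign L α w₀) 2)]).map w₀.1.embedding))) : GL (Fin 2) ℂ) : Matrix (Fin 2) (Fin 2) ℂ) =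
      (boostStd (formRe L α w₀ ∘ τ₀) (c₁ w₀)).submatrix ![0, 2] ![0, 2] := h5b c₁
  obtain ⟨u₁, hu₁⟩ := h9 γ₁
  have hX₁ : endoGL ((((e γ₁).1 : ↥(unitaryGroupOfForm (starRingEnd ℂ) ((Matrix.diagonal ![α (lineOf (formSign L α w₀) 0), α (lineOf (formSign L α w₀) 2)]).map w₀.1.embedding))) : GL (Fin 2) ℂ), ((u₁ : ↥(unitaryGroupOfForm (starRingEnd ℂ) ((Matrix.diagonal ![(α ∘ (lineOf (formSign L α w₀))) 1]).map w₀.1.embedding))) : GL (Fin 1) ℂ)) =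
      Matrix.GeneralLinearGroup.mkOfDetNeZero (boostStd (formRe L α w₀ ∘ τ₀) (c₁ w₀)) (det_boostStd_ne_zero _ _) := by
    have hL : ((archPiEquivCM 3 L (Matrix.diagonal α) (gprimeTorus L α (insert w₀ S') c₁) w₀ : ↥(archLocal L 3 (Matrix.diagonal α) w₀)) : GL (Fin 3) ℂ) =
        gprimeSplitGL τ₀ (formRe L α w₀) (c₁ w₀) := by
      rw [archPiEquivCM_gprimeTorus]
      exact coe_gprimeBlock_of_mem L α c₁ (Finset.mem_insert_self w₀ S') hsp
    have hGL := congrArg (fun y : ↥(archLocal L 3 (Matrix.diagonal α) w₀) => (y : GL (Fin 3) ℂ)) hu₁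
    rw [hL] at hGL
    have key : Mτ * endoGL ((((e γ₁).1 : ↥(unitaryGroupOfForm (starRingEnd ℂ) ((Matrix.diagonal ![α (lineOf (formSign L α w₀) 0), α (lineOf (formSign L α w₀) 2)]).map w₀.1.embedding))) : GL (Fin 2) ℂ), ((u₁ : ↥(unitaryGroupOfForm (starRingEnd ℂ) ((Matrix.diagonal ![(α ∘ (lineOf (formSign L α w₀))) 1]).map w₀.1.embedding))) : GL (Fin 1) ℂ)) * Mτ⁻¹ =
        Mτ * Matrix.GeneralLinearGroup.mkOfDetNeZero (boostStd (formRe L α w₀ ∘ τ₀) (c₁ w₀)) (det_boostStd_ne_zero _ _) * Mτ⁻¹ := by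
      rw [conj_monomialGL_boostStd_eq_gprimeSplitGL τ₀ (formRe L α w₀) (c₁ w₀)]
      exact hGL.symm
    exact mul_left_cancel (mul_right_cancel key)
  intro g
  -- commuting with `γ₁` in `M′` ⟺ the `B`-components commute (`e` is an isomorphism, `K` is commutative)
  have hiff₁ : (g : G) ∈ chartTorusG L α (insert w₀ S') ↔ (e g).1 * (e γ₁).1 = (e γ₁).1 * (e g).1 := by
    rw [hTins, Subgroup.mem_centralizer_singleton_iff]
    constructor
    · intro hc
      have hM : g * γ₁ = γ₁ * g := Subtype.ext hc
      have := congrArg (fun x : ↥M' => (e x).1) hM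
      simpa only [map_mul, Prod.fst_mul] using this
    · intro hc
      have hK : (e g).2 * (e γ₁).2 = (e γ₁).2 * (e g).2 :=
        Subtype.ext (h3 _ ((e g).2).2 _ ((e γ₁).2).2)
      have hM : e (g * γ₁) = e (γ₁ * g) := by
        rw [map_mul, map_mul]
        exact Prod.ext hc hK
      exact congrArg Subtype.val (e.injective hM)
  rw [hiff₁]
  constructor
  · intro hc
    -- the 3 × 3 endoscopic pattern `N = endoGL ((e g).1, 1)` commutes with the regular boost and is `diag(b)`-unitary
    have hcGL : ((((e g).1 : ↥(unitaryGroupOfForm (starRingEnd ℂ) ((Matrix.diagonal ![α (lineOf (formSign L α w₀) 0), α (lineOf (formSign L α w₀) 2)]).map w₀.1.embedding))) : GL (Fin 2) ℂ)) * (((e γ₁).1 : ↥(unitaryGroupOfForm (starRingEnd ℂ) ((Matrix.diagonal ![α (lineOf (formSign L α w₀) 0), α (lineOf (formSign L α w₀) 2)]).map w₀.1.embedding))) : GL (Fin 2) ℂ) =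
        (((e γ₁).1 : ↥(unitaryGroupOfForm (starRingEnd ℂ) ((Matrix.diagonal ![α (lineOf (formSign L α w₀) 0), α (lineOf (formSign L α w₀) 2)]).map w₀.1.embedding))) : GL (Fin 2) ℂ) * (((e g).1 : ↥(unitaryGroupOfForm (starRingEnd ℂ) ((Matrix.diagonal ![α (lineOf (formSign L α w₀) 0), α (lineOf (formSign L α w₀) 2)]).map w₀.1.embedding))) : GL (Fin 2) ℂ) := by
      rw [← Subgroup.coe_mul, ← Subgroup.coe_mul, hc]
    have hNGL : endoGL ((((e g).1 : ↥(unitaryGroupOfForm (starRingEnd ℂ) ((Matrix.diagonal ![α (lineOf (formSign L α w₀) 0), α (lineOf (formSign L α w₀) 2)]).map w₀.1.embedding))) : GL (Fin 2) ℂ), (1 : GL (Fin 1) ℂ)) *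
          Matrix.GeneralLinearGroup.mkOfDetNeZero (boostStd (formRe L α w₀ ∘ τ₀) (c₁ w₀)) (det_boostStd_ne_zero _ _) =
        Matrix.GeneralLinearGroup.mkOfDetNeZero (boostStd (formRe L α w₀ ∘ τ₀) (c₁ w₀)) (det_boostStd_ne_zero _ _) *
          endoGL ((((e g).1 : ↥(unitaryGroupOfForm (starRingEnd ℂ) ((Matrix.diagonal ![α (lineOf (formSign L α w₀) 0), α (lineOf (formSign L α w₀) 2)]).map w₀.1.embedding))) : GL (Fin 2) ℂ), (1 : GL (Fin 1) ℂ)) := by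
      rw [← hX₁, ← map_mul, ← map_mul, Prod.mk_mul_mk, Prod.mk_mul_mk, one_mul, mul_one, hcGL]
    have hM : ((endoGL ((((e g).1 : ↥(unitaryGroupOfForm (starRingEnd ℂ) ((Matrix.diagonal ![α (lineOf (formSign L α w₀) 0), α (lineOf (formSign L α w₀) 2)]).map w₀.1.embedding))) : GL (Fin 2) ℂ), (1 : GL (Fin 1) ℂ)) : GL (Fin 3) ℂ) : Matrix (Fin 3) (Fin 3) ℂ) *
          boostStd (formRe L α w₀ ∘ τ₀) (c₁ w₀) =
        boostStd (formRe L α w₀ ∘ τ₀) (c₁ w₀) * ((endoGL ((((e g).1 : ↥(unitaryGroupOfForm (starRingEnd ℂ) ((Matrix.diagonal ![α (lineOf (formSign L α w₀) 0), α (lineOf (formSign L α w₀) 2)]).map w₀.1.embedding))) : GL (Fin 2) ℂ), (1 : GL (Fin 1) ℂ)) : GL (Fin 3) ℂ) :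
          Matrix (Fin 3) (Fin 3) ℂ) := by
      have := congrArg (fun x : GL (Fin 3) ℂ => (x : Matrix (Fin 3) (Fin 3) ℂ)) hNGL
      simpa only [Units.val_mul, Matrix.GeneralLinearGroup.val_mkOfDetNeZero] using this
    -- unitarity of `N` for `diag(b)`: `N = ENDO ((e g).1, 1)` lies in `U(σ_{w₀} diag (α ∘ τ₀))`
    have hU : (((endoGL ((((e g).1 : ↥(unitaryGroupOfForm (starRingEnd ℂ) ((Matrix.diagonal ![α (lineOf (formSign L α w₀) 0), α (lineOf (formSign L α w₀) 2)]).map w₀.1.embedding))) : GL (Fin 2) ℂ), (1 : GL (Fin 1) ℂ)) : GL (Fin 3) ℂ) : Matrix (Fin 3) (Fin 3) ℂ))ᴴ *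
          Matrix.diagonal (fun i => (((formRe L α w₀ ∘ τ₀) i : ℝ) : ℂ)) *
          ((endoGL ((((e g).1 : ↥(unitaryGroupOfForm (starRingEnd ℂ) ((Matrix.diagonal ![α (lineOf (formSign L α w₀) 0), α (lineOf (formSign L α w₀) 2)]).map w₀.1.embedding))) : GL (Fin 2) ℂ), (1 : GL (Fin 1) ℂ)) : GL (Fin 3) ℂ) : Matrix (Fin 3) (Fin 3) ℂ) =
        Matrix.diagonal (fun i => (((formRe L α w₀ ∘ τ₀) i : ℝ) : ℂ)) := by
      have hmem := (ENDO ((e g).1, 1)).2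
      have h := (mem_archLocal_iff_conjTranspose L 3 (Matrix.diagonal (α ∘ τ₀)) w₀ _).1 hmem
      have h' : ((endoGL ((((e g).1 : ↥(unitaryGroupOfForm (starRingEnd ℂ) ((Matrix.diagonal ![α (lineOf (formSign L α w₀) 0), α (lineOf (formSign L α w₀) 2)]).map w₀.1.embedding))) : GL (Fin 2) ℂ), (1 : GL (Fin 1) ℂ)) : GL (Fin 3) ℂ) : Matrix (Fin 3) (Fin 3) ℂ)ᴴ *
            (Matrix.diagonal (α ∘ τ₀)).map w₀.1.embedding *
            ((endoGL ((((e g).1 : ↥(unitaryGroupOfForm (starRingEnd ℂ) ((Matrix.diagonal ![α (lineOf (formSign L α w₀) 0), α (lineOf (formSign L α w₀) 2)]).map w₀.1.embedding))) : GL (Fin 2) ℂ), (1 : GL (Fin 1) ℂ)) : GL (Fin 3) ℂ) : Matrix (Fin 3) (Fin 3) ℂ) =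
          (Matrix.diagonal (α ∘ τ₀)).map w₀.1.embedding := h
      rw [diagonal_map_embedding_eq_of_real (L := L) (α := α ∘ τ₀) (w := w₀) (fun i => hsp.1 (τ₀ i))] at h'
      exact h'
    have hx : (c₁ w₀) 0 ≠ 0 := by rw [hc₁w₀]; exact one_ne_zero
    obtain ⟨c', hc'⟩ := exists_eq_boostStd_of_commute hb hb1 hx hM hU
    refine ⟨c' 0, c' 2, ?_⟩
    rw [← submatrix_boostStd_eq_of]
    have hmat := hc'
    rw [coe_endoGL_eq] at hmat
    ext i j
    fin_cases i <;> fin_cases j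
    · exact congrFun (congrFun hmat 0) 0
    · exact congrFun (congrFun hmat 0) 2
    · exact congrFun (congrFun hmat 2) 0
    · exact congrFun (congrFun hmat 2) 2
  · rintro ⟨x, θ, hxθ⟩
    apply Subtype.ext
    apply Units.ext
    rw [Subgroup.coe_mul, Subgroup.coe_mul, Units.val_mul, Units.val_mul, hxθ, hb₁]
    exact submatrix_boostStd_comm hb _ _

end CayleyTorus

end Literature.NumberTheory.Automorphic.UnitaryGroup

end
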